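import Summits.CriticalPhenomena.PercolationContinuityZ3.Theorems.PercNearOneGluingNoHeavyLowerTailSahiThreeCopyMixedFacts

/-!
# `NoHeavyLowerTail` (crux stmt-CriticalPhenomena-4575), Sahi programme: **3C-SAHI IS STABLE UNDER ARBITRARY LITERAL ADJUNCTION** — adjoin a fresh
# coordinate `x₀` to each of the three slots INDEPENDENTLY as nothing / `∧ x₀` / `∨ x₀` (27 patterns); hence every triple of CATERPILLAR READ-ONCE
# events over a common variable order satisfies the three-copy Sahi inequality at every profile, in particular every triple of up-sets of `{0,1}²`

Support file (Sahi cell, seat `prim-sahi-p1`, generation 54; `--supports stmt-CriticalPhenomena-4575`); companion of `…SahiThreeCopyLiterals` (the pure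
patterns all-`∨` / all-`∧`) and `…SahiThreeCopyMixedFacts` (the fifteen-coordinate fact bundle).  Pure proofs plus definitions (`Kind`, `litAdj`, `litAdjoin`);
no `sorry`, standard axioms.

* `litAdj κ f` (`κ : Kind ∈ {skip, andL, orL}`): `f`, `f ∧ x₀`, `f ∨ x₀` on `{0,1}^{d+1}`; its sections along the fresh coordinate lie in `{0, f, 1}`, so by the
  slice recursion `N3_cons` the coefficient `c_{(k,b)}` of the extended triple is a LINEAR form in the fifteen three-copy counts of `(f,g,h)` at `b`.
* ★★ `tc_litAdj_cons_nonneg` (from the four slice values `…_0 … _3`): for monotone `f, g, h : {0,1}^d → [0,1]` with `0 ≤ c_b(f,g,h)`: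
  `0 ≤ c_{(k,b)}(litAdj κ₁ f, litAdj κ₂ g, litAdj κ₃ h)` for ALL `κ₁, κ₂, κ₃` and `k`.  Each of the 108 cases is a nonnegative combination (found by exact LP,
  memo FROM-prim-sahi-p1-gen54-READONCE-CLOSURE §3e, code `mixed_adj.py` / `closure_family4.py`; here re-found by `linarith`) of `c_b(f,g,h) ≥ 0` and the
  theorem-grade inequalities `MixedFacts` (Harris chains, SPECTATOR-Harris `H(f,g) ≥ H(f,g|h)`, union-Harris, Bonferroni / inclusion–exclusion).
* `tc_litAdjoin_nonneg`: iteration over `m` fresh coordinates with three independent gate sequences; `tc_const_nonneg`: constant triples have `c_b = 0`; so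
  ★ `tc_litAdjoin_const_nonneg`: EVERY TRIPLE OF CATERPILLAR READ-ONCE FUNCTIONS `x_{1} ∘₁ (x_{2} ∘₂ (⋯(x_m ∘_m c)))`, `∘_i ∈ {∧, ∨, skip}` chosen independently for
  the three events, satisfies 3C-SAHI at every profile (all six up-sets of `{0,1}²` are of this form over the order `x₁, x₂`, so every triple of up-sets of the
  square is covered; with `…Blocks` / `…BlockOr` these serve as leaves of read-once compositions).
[this work; conjecture: CENSUS §175 W197 (prim-sahi-census gen 54)]
-/

namespace Summit.CriticalPhenomena.PercolationContinuityZ3.Theorems.SahiThreeCopy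

open Finset Function Literature.Combinatorics.Sahi2008
open scoped BigOperators

noncomputable section

variable {d : ℕ}

/-! ### §1 Literal adjunction of the three kinds -/

/-- How a fresh literal is adjoined to a slot: not at all, by `∧`, or by `∨`. [this work] -/
inductive Kind
  | skip
  | andL
  | orL

/-- `litAdj κ f`: `f` (skip), `f ∧ x₀`, or `f ∨ x₀` on `{0,1}^{d+1}` (fresh coordinate in front). [this work] -/
def litAdj : Kind → (Pt d → ℝ) → Pt (d + 1) → ℝ
  | .skip, f => fun x => f (Fin.tail x)
  | .andL, f => fun x => if x 0 = true then f (Fin.tail x) else 0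
  | .orL, f => fun x => if x 0 = true then 1 else f (Fin.tail x)

/-- Sections of `litAdj skip f`. [this work] -/
@[simp] theorem sec_litAdj_skip (f : Pt d → ℝ) (ε : Bool) : sec (litAdj Kind.skip f) ε = f := by
  funext x; simp [sec, litAdj, Fin.tail_cons]

/-- Top section of `f ∧ x₀`. [this work] -/
@[simp] theorem sec_litAdj_and_true (f : Pt d → ℝ) : sec (litAdj Kind.andL f) true = f := by
  funext x; simp [sec, litAdj, Fin.tail_cons, Fin.cons_zero]

/-- Bottom section of `f ∧ x₀`. [this work] -/
@[simp] theorem sec_litAdj_and_false (f : Pt d → ℝ) : sec (litAdj Kind.andL f) false = 0 := by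
  funext x; simp [sec, litAdj, Fin.cons_zero]

/-- Top section of `f ∨ x₀`. [this work] -/
@[simp] theorem sec_litAdj_or_true (f : Pt d → ℝ) : sec (litAdj Kind.orL f) true = 1 := by
  funext x; simp [sec, litAdj, Fin.cons_zero]

/-- Bottom section of `f ∨ x₀`. [this work] -/
@[simp] theorem sec_litAdj_or_false (f : Pt d → ℝ) : sec (litAdj Kind.orL f) false = f := by
  funext x; simp [sec, litAdj, Fin.tail_cons, Fin.cons_zero]

/-- `litAdj` preserves `0 ≤ · ≤ 1` and monotonicity. [this work] -/
theorem litAdj_props (κ : Kind) {f : Pt d → ℝ} (hf0 : ∀ x, 0 ≤ f x) (hf1 : ∀ x, f x ≤ 1) (hfm : Monotone f) :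
    (∀ x, 0 ≤ litAdj κ f x) ∧ (∀ x, litAdj κ f x ≤ 1) ∧ Monotone (litAdj κ f) := by
  have ht : ∀ {x y : Pt (d + 1)}, x ≤ y → Fin.tail x ≤ Fin.tail y := fun hxy i => hxy i.succ
  have h01 : ∀ {x y : Pt (d + 1)}, x ≤ y → x 0 = true → y 0 = true := fun hxy hx => Bool.eq_true_of_true_le (hx ▸ hxy 0)
  cases κ with
  | skip => exact ⟨fun x => hf0 _, fun x => hf1 _, fun x y hxy => hfm (ht hxy)⟩
  | andL =>
    refine ⟨fun x => ?_, fun x => ?_, fun x y hxy => ?_⟩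
    · simp only [litAdj]; split_ifs; exacts [hf0 _, le_rfl]
    · simp only [litAdj]; split_ifs; exacts [hf1 _, zero_le_one]
    · simp only [litAdj]
      by_cases hx : x 0 = true
      · rw [if_pos hx, if_pos (h01 hxy hx)]; exact hfm (ht hxy)
      · rw [if_neg hx]; split_ifs; exacts [hf0 _, le_rfl]
  | orL =>
    refine ⟨fun x => ?_, fun x => ?_, fun x y hxy => ?_⟩
    · simp only [litAdj]; split_ifs; exacts [zero_le_one, hf0 _]
    · simp only [litAdj]; split_ifs; exacts [le_rfl, hf1 _]
    · simp only [litAdj]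
      by_cases hx : x 0 = true
      · rw [if_pos hx, if_pos (h01 hxy hx)]
      · rw [if_neg hx]; split_ifs; exacts [hf1 _, hfm (ht hxy)]

/-! ### §2 The mixed-literal step, slice value by slice value -/

/-- The mixed-literal step at slice value `k = 0` (27 patterns, each a linear certificate over `MixedFacts` and `c_b ≥ 0`). [this work] -/
theorem tc_litAdj_cons_nonneg_0 (b : Fin d → ℕ) (κ₁ κ₂ κ₃ : Kind) {f g h : Pt d → ℝ}
    (hf0 : ∀ x, 0 ≤ f x) (hf1 : ∀ x, f x ≤ 1) (hfm : Monotone f) (hg0 : ∀ x, 0 ≤ g x) (hg1 : ∀ x, g x ≤ 1) (hgm : Monotone g)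
    (hh0 : ∀ x, 0 ≤ h x) (hh1 : ∀ x, h x ≤ 1) (hhm : Monotone h) (htc : 0 ≤ tc b f g h) :
    0 ≤ tc (Fin.cons 0 b : Fin (d + 1) → ℕ) (litAdj κ₁ f) (litAdj κ₂ g) (litAdj κ₃ h) := by
  obtain ⟨z0, nf0, ng0, nh0, hfg0, sfg0, hfh0, sfh0, hgh0, sgh0, n00, nA0, nB0, nC0, n30, fZ, gZ, hZ, fg_f, fg_g, fh_f, fh_h, gh_g, gh_h, sfg_f, sfg_g, sfh_f, sfh_h, sgh_g, sgh_h, n0_fg, n0_fh, n0_gh, nA_sfg, nA_sfh, nB_sfg, nB_sgh, nC_sfh, nC_sgh, Hfg, Hfh, Hgh, HA, HB, HC, H3A, H3B, H3C, SpC, SpB, SpA, Uf, Ug, Uh, Bf, Bg, Bh, Bfg_h, Bfh_g, Bgf_h, Bgh_f, Bhf_g, Bhg_f, I2fg, I2fh, I2gh, I2fg', I2fh', I2gh', I3, I3', I3f, I3g, I3h⟩ :=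
    mixedFacts_of b hf0 hf1 hfm hg0 hg1 hgm hh0 hh1 hhm
  unfold tc at htc ⊢
  rw [N3_cons, N3_cons, N3_cons, N3_cons, N3_cons]
  simp only [Fintype.sum_bool, Bool.toNat_true, Bool.toNat_false, sec_mul, sec_one]
  norm_num
  cases κ₁ <;> cases κ₂ <;> cases κ₃ <;>
    simp only [sec_litAdj_skip, sec_litAdj_and_false, sec_litAdj_or_false, mul_zero, zero_mul, N3_zero_left, N3_zero_mid', N3_zero_right'] <;>
    linarith

/-- The mixed-literal step at slice value `k = 1` (27 patterns, each a linear certificate over `MixedFacts` and `c_b ≥ 0`). [this work] -/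
theorem tc_litAdj_cons_nonneg_1 (b : Fin d → ℕ) (κ₁ κ₂ κ₃ : Kind) {f g h : Pt d → ℝ}
    (hf0 : ∀ x, 0 ≤ f x) (hf1 : ∀ x, f x ≤ 1) (hfm : Monotone f) (hg0 : ∀ x, 0 ≤ g x) (hg1 : ∀ x, g x ≤ 1) (hgm : Monotone g)
    (hh0 : ∀ x, 0 ≤ h x) (hh1 : ∀ x, h x ≤ 1) (hhm : Monotone h) (htc : 0 ≤ tc b f g h) :
    0 ≤ tc (Fin.cons 1 b : Fin (d + 1) → ℕ) (litAdj κ₁ f) (litAdj κ₂ g) (litAdj κ₃ h) := by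
  obtain ⟨z0, nf0, ng0, nh0, hfg0, sfg0, hfh0, sfh0, hgh0, sgh0, n00, nA0, nB0, nC0, n30, fZ, gZ, hZ, fg_f, fg_g, fh_f, fh_h, gh_g, gh_h, sfg_f, sfg_g, sfh_f, sfh_h, sgh_g, sgh_h, n0_fg, n0_fh, n0_gh, nA_sfg, nA_sfh, nB_sfg, nB_sgh, nC_sfh, nC_sgh, Hfg, Hfh, Hgh, HA, HB, HC, H3A, H3B, H3C, SpC, SpB, SpA, Uf, Ug, Uh, Bf, Bg, Bh, Bfg_h, Bfh_g, Bgf_h, Bgh_f, Bhf_g, Bhg_f, I2fg, I2fh, I2gh, I2fg', I2fh', I2gh', I3, I3', I3f, I3g, I3h⟩ :=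
    mixedFacts_of b hf0 hf1 hfm hg0 hg1 hgm hh0 hh1 hhm
  unfold tc at htc ⊢
  rw [N3_cons, N3_cons, N3_cons, N3_cons, N3_cons]
  simp only [Fintype.sum_bool, Bool.toNat_true, Bool.toNat_false, sec_mul, sec_one]
  norm_num
  cases κ₁ <;> cases κ₂ <;> cases κ₃ <;>
    simp only [sec_litAdj_skip, sec_litAdj_and_true, sec_litAdj_and_false, sec_litAdj_or_true, sec_litAdj_or_false, mul_one, one_mul, mul_zero, zero_mul, N3_zero_left, N3_zero_mid', N3_zero_right', N3_comm12 b 1 (f * g) 1, N3_comm12 b 1 (f * h) 1, N3_comm12 b 1 (g * h) 1, N3_comm12 b g f 1, N3_comm12 b h f 1, N3_comm12 b h g 1, N3_comm23 b f 1 h, N3_comm12 b 1 g h, N3_comm23 b g 1 h] <;>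
    linarith

/-- The mixed-literal step at slice value `k = 2` (27 patterns, each a linear certificate over `MixedFacts` and `c_b ≥ 0`). [this work] -/
theorem tc_litAdj_cons_nonneg_2 (b : Fin d → ℕ) (κ₁ κ₂ κ₃ : Kind) {f g h : Pt d → ℝ}
    (hf0 : ∀ x, 0 ≤ f x) (hf1 : ∀ x, f x ≤ 1) (hfm : Monotone f) (hg0 : ∀ x, 0 ≤ g x) (hg1 : ∀ x, g x ≤ 1) (hgm : Monotone g)
    (hh0 : ∀ x, 0 ≤ h x) (hh1 : ∀ x, h x ≤ 1) (hhm : Monotone h) (htc : 0 ≤ tc b f g h) :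
    0 ≤ tc (Fin.cons 2 b : Fin (d + 1) → ℕ) (litAdj κ₁ f) (litAdj κ₂ g) (litAdj κ₃ h) := by
  obtain ⟨z0, nf0, ng0, nh0, hfg0, sfg0, hfh0, sfh0, hgh0, sgh0, n00, nA0, nB0, nC0, n30, fZ, gZ, hZ, fg_f, fg_g, fh_f, fh_h, gh_g, gh_h, sfg_f, sfg_g, sfh_f, sfh_h, sgh_g, sgh_h, n0_fg, n0_fh, n0_gh, nA_sfg, nA_sfh, nB_sfg, nB_sgh, nC_sfh, nC_sgh, Hfg, Hfh, Hgh, HA, HB, HC, H3A, H3B, H3C, SpC, SpB, SpA, Uf, Ug, Uh, Bf, Bg, Bh, Bfg_h, Bfh_g, Bgf_h, Bgh_f, Bhf_g, Bhg_f, I2fg, I2fh, I2gh, I2fg', I2fh', I2gh', I3, I3', I3f, I3g, I3h⟩ :=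
    mixedFacts_of b hf0 hf1 hfm hg0 hg1 hgm hh0 hh1 hhm
  unfold tc at htc ⊢
  rw [N3_cons, N3_cons, N3_cons, N3_cons, N3_cons]
  simp only [Fintype.sum_bool, Bool.toNat_true, Bool.toNat_false, sec_mul, sec_one]
  norm_num
  cases κ₁ <;> cases κ₂ <;> cases κ₃ <;>
    simp only [sec_litAdj_skip, sec_litAdj_and_true, sec_litAdj_and_false, sec_litAdj_or_true, sec_litAdj_or_false, mul_one, one_mul, mul_zero, zero_mul, N3_zero_left, N3_zero_mid', N3_zero_right', N3_comm12 b 1 f 1, N3_comm12 b 1 g 1, N3_comm12 b 1 h 1, N3_comm12 b 1 (f * g) 1, N3_comm12 b 1 (f * h) 1, N3_comm12 b 1 (g * h) 1, N3_comm12 b g f 1, N3_comm12 b h f 1, N3_comm12 b h g 1, N3_comm23 b f 1 h, N3_comm12 b 1 g h, N3_comm23 b g 1 h, N3_comm13 b 1 1 h] <;>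
    linarith

/-- The mixed-literal step at slice value `k = 3` (27 patterns, each a linear certificate over `MixedFacts` and `c_b ≥ 0`). [this work] -/
theorem tc_litAdj_cons_nonneg_3 (b : Fin d → ℕ) (κ₁ κ₂ κ₃ : Kind) {f g h : Pt d → ℝ}
    (hf0 : ∀ x, 0 ≤ f x) (hf1 : ∀ x, f x ≤ 1) (hfm : Monotone f) (hg0 : ∀ x, 0 ≤ g x) (hg1 : ∀ x, g x ≤ 1) (hgm : Monotone g)
    (hh0 : ∀ x, 0 ≤ h x) (hh1 : ∀ x, h x ≤ 1) (hhm : Monotone h) (htc : 0 ≤ tc b f g h) :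
    0 ≤ tc (Fin.cons 3 b : Fin (d + 1) → ℕ) (litAdj κ₁ f) (litAdj κ₂ g) (litAdj κ₃ h) := by
  obtain ⟨z0, nf0, ng0, nh0, hfg0, sfg0, hfh0, sfh0, hgh0, sgh0, n00, nA0, nB0, nC0, n30, fZ, gZ, hZ, fg_f, fg_g, fh_f, fh_h, gh_g, gh_h, sfg_f, sfg_g, sfh_f, sfh_h, sgh_g, sgh_h, n0_fg, n0_fh, n0_gh, nA_sfg, nA_sfh, nB_sfg, nB_sgh, nC_sfh, nC_sgh, Hfg, Hfh, Hgh, HA, HB, HC, H3A, H3B, H3C, SpC, SpB, SpA, Uf, Ug, Uh, Bf, Bg, Bh, Bfg_h, Bfh_g, Bgf_h, Bgh_f, Bhf_g, Bhg_f, I2fg, I2fh, I2gh, I2fg', I2fh', I2gh', I3, I3', I3f, I3g, I3h⟩ :=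
    mixedFacts_of b hf0 hf1 hfm hg0 hg1 hgm hh0 hh1 hhm
  unfold tc at htc ⊢
  rw [N3_cons, N3_cons, N3_cons, N3_cons, N3_cons]
  simp only [Fintype.sum_bool, Bool.toNat_true, Bool.toNat_false, sec_mul, sec_one]
  norm_num
  cases κ₁ <;> cases κ₂ <;> cases κ₃ <;>
    simp only [sec_litAdj_skip, sec_litAdj_and_true, sec_litAdj_or_true, mul_one, one_mul, N3_comm12 b 1 f 1, N3_comm12 b 1 g 1, N3_comm12 b 1 h 1, N3_comm12 b 1 (f * g) 1, N3_comm12 b 1 (f * h) 1, N3_comm12 b 1 (g * h) 1, N3_comm12 b g f 1, N3_comm12 b h f 1, N3_comm12 b h g 1, N3_comm23 b f 1 h, N3_comm12 b 1 g h, N3_comm23 b g 1 h, N3_comm13 b 1 1 h] <;>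
    linarith

/-- ★★ **3C-SAHI IS STABLE UNDER ARBITRARY LITERAL ADJUNCTION**: for monotone `f, g, h : {0,1}^d → [0,1]` with `0 ≤ c_b(f,g,h)` and any kinds
`κ₁, κ₂, κ₃ ∈ {skip, ∧x₀, ∨x₀}` and any `k`: `0 ≤ c_{(k,b)}(litAdj κ₁ f, litAdj κ₂ g, litAdj κ₃ h)`. [this work] -/
theorem tc_litAdj_cons_nonneg (k : ℕ) (b : Fin d → ℕ) (κ₁ κ₂ κ₃ : Kind) {f g h : Pt d → ℝ}
    (hf0 : ∀ x, 0 ≤ f x) (hf1 : ∀ x, f x ≤ 1) (hfm : Monotone f) (hg0 : ∀ x, 0 ≤ g x) (hg1 : ∀ x, g x ≤ 1) (hgm : Monotone g)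
    (hh0 : ∀ x, 0 ≤ h x) (hh1 : ∀ x, h x ≤ 1) (hhm : Monotone h) (htc : 0 ≤ tc b f g h) :
    0 ≤ tc (Fin.cons k b : Fin (d + 1) → ℕ) (litAdj κ₁ f) (litAdj κ₂ g) (litAdj κ₃ h) := by
  rcases Nat.lt_or_ge k 4 with hk | hk
  · interval_cases k
    · exact tc_litAdj_cons_nonneg_0 b κ₁ κ₂ κ₃ hf0 hf1 hfm hg0 hg1 hgm hh0 hh1 hhm htc
    · exact tc_litAdj_cons_nonneg_1 b κ₁ κ₂ κ₃ hf0 hf1 hfm hg0 hg1 hgm hh0 hh1 hhm htc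
    · exact tc_litAdj_cons_nonneg_2 b κ₁ κ₂ κ₃ hf0 hf1 hfm hg0 hg1 hgm hh0 hh1 hhm htc
    · exact tc_litAdj_cons_nonneg_3 b κ₁ κ₂ κ₃ hf0 hf1 hfm hg0 hg1 hgm hh0 hh1 hhm htc
  · obtain ⟨j, rfl⟩ : ∃ j, k = j + 4 := ⟨k - 4, by omega⟩
    unfold tc
    simp [N3_cons_add_four]

/-! ### §3 Iteration: independent caterpillar read-once events -/

/-- Adjoin `m` fresh front coordinates with the gate sequence `K : Fin m → Kind`: `litAdjoin m K f = x₀ ∘_{K 0} (x₁ ∘_{K 1} (⋯ (x_{m−1} ∘ f)))`. [this work] -/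
def litAdjoin : (m : ℕ) → (Fin m → Kind) → (Pt d → ℝ) → Pt (d + m) → ℝ
  | 0, _, f => f
  | m + 1, K, f => litAdj (K 0) (litAdjoin m (Fin.tail K) f)

/-- `litAdjoin` preserves `0 ≤ · ≤ 1` and monotonicity. [this work] -/
theorem litAdjoin_props : ∀ (m : ℕ) (K : Fin m → Kind) {f : Pt d → ℝ}, (∀ x, 0 ≤ f x) → (∀ x, f x ≤ 1) → Monotone f →
    (∀ x, 0 ≤ litAdjoin m K f x) ∧ (∀ x, litAdjoin m K f x ≤ 1) ∧ Monotone (litAdjoin m K f)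
  | 0, _, _, h0, h1, hm => ⟨h0, h1, hm⟩
  | m + 1, K, _, h0, h1, hm => by
    obtain ⟨i0, i1, im⟩ := litAdjoin_props m (Fin.tail K) h0 h1 hm
    exact litAdj_props (K 0) i0 i1 im

/-- ★★ **Independent literal adjunction preserves 3C-SAHI at all profiles.** [this work] -/
theorem tc_litAdjoin_nonneg : ∀ (m : ℕ) (K₁ K₂ K₃ : Fin m → Kind) {f g h : Pt d → ℝ}, (∀ x, 0 ≤ f x) → (∀ x, f x ≤ 1) → Monotone f →
    (∀ x, 0 ≤ g x) → (∀ x, g x ≤ 1) → Monotone g → (∀ x, 0 ≤ h x) → (∀ x, h x ≤ 1) → Monotone h →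
    (∀ b : Fin d → ℕ, 0 ≤ tc b f g h) → ∀ b : Fin (d + m) → ℕ, 0 ≤ tc b (litAdjoin m K₁ f) (litAdjoin m K₂ g) (litAdjoin m K₃ h)
  | 0, _, _, _, _, _, _, _, _, _, _, _, _, _, _, _, htc, b => htc b
  | m + 1, K₁, K₂, K₃, _, _, _, hf0, hf1, hfm, hg0, hg1, hgm, hh0, hh1, hhm, htc, b => by
    obtain ⟨f0, f1, fm⟩ := litAdjoin_props m (Fin.tail K₁) hf0 hf1 hfm
    obtain ⟨g0, g1, gm⟩ := litAdjoin_props m (Fin.tail K₂) hg0 hg1 hgm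
    obtain ⟨h0', h1', hm'⟩ := litAdjoin_props m (Fin.tail K₃) hh0 hh1 hhm
    have IH := tc_litAdjoin_nonneg m (Fin.tail K₁) (Fin.tail K₂) (Fin.tail K₃) hf0 hf1 hfm hg0 hg1 hgm hh0 hh1 hhm htc (Fin.tail b)
    have hb : b = Fin.cons (b 0) (Fin.tail b) := (Fin.cons_self_tail b).symm
    rw [hb]
    exact tc_litAdj_cons_nonneg (b 0) (Fin.tail b) (K₁ 0) (K₂ 0) (K₃ 0) f0 f1 fm g0 g1 gm h0' h1' hm' IH

/-- `N_b` of three constants. [this work] -/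
theorem N3_const (b : Fin d → ℕ) (c₁ c₂ c₃ : ℝ) :
    N3 b (fun _ => c₁) (fun _ => c₂) (fun _ => c₃) = c₁ * c₂ * c₃ * N3 b 1 1 1 := by
  have e1 : (fun _ : Pt d => c₁) = c₁ • (1 : Pt d → ℝ) := by funext x; simp
  have e2 : (fun _ : Pt d => c₂) = c₂ • (1 : Pt d → ℝ) := by funext x; simp
  have e3 : (fun _ : Pt d => c₃) = c₃ • (1 : Pt d → ℝ) := by funext x; simp
  rw [e1, e2, e3, N3_smul_left, N3_smul_mid, N3_smul_right]; ring

/-- Constant triples have `c_b = 0` (coefficientwise `E₃(c₁,c₂,c₃) = 0`). [this work] -/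
theorem tc_const (b : Fin d → ℕ) (c₁ c₂ c₃ : ℝ) : tc b (fun _ => c₁) (fun _ => c₂) (fun _ => c₃) = 0 := by
  unfold tc
  have p123 : ((fun _ : Pt d => c₁) * (fun _ => c₂) * fun _ => c₃) = fun _ => c₁ * c₂ * c₃ := by funext x; simp
  have p23 : ((fun _ : Pt d => c₂) * fun _ => c₃) = fun _ => c₂ * c₃ := by funext x; simp
  have p13 : ((fun _ : Pt d => c₁) * fun _ => c₃) = fun _ => c₁ * c₃ := by funext x; simp
  have p12 : ((fun _ : Pt d => c₁) * fun _ => c₂) = fun _ => c₁ * c₂ := by funext x; simp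
  have one : (1 : Pt d → ℝ) = fun _ => (1 : ℝ) := rfl
  rw [p123, p23, p13, p12, one, N3_const, N3_const, N3_const, N3_const, N3_const]
  ring

/-- ★ **EVERY TRIPLE OF INDEPENDENT CATERPILLAR READ-ONCE FUNCTIONS SATISFIES 3C-SAHI**: starting from constants `c₁, c₂, c₃ ∈ [0,1]` on `{0,1}^d` and
adjoining `m` fresh coordinates with three arbitrary gate sequences, `c_b ≥ 0` at every profile of `{0,1}^{d+m}`. [this work] -/
theorem tc_litAdjoin_const_nonneg (m : ℕ) (K₁ K₂ K₃ : Fin m → Kind) {c₁ c₂ c₃ : ℝ} (h₁ : 0 ≤ c₁ ∧ c₁ ≤ 1) (h₂ : 0 ≤ c₂ ∧ c₂ ≤ 1)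
    (h₃ : 0 ≤ c₃ ∧ c₃ ≤ 1) (b : Fin (d + m) → ℕ) :
    0 ≤ tc b (litAdjoin m K₁ (fun _ : Pt d => c₁)) (litAdjoin m K₂ (fun _ : Pt d => c₂)) (litAdjoin m K₃ (fun _ : Pt d => c₃)) :=
  tc_litAdjoin_nonneg m K₁ K₂ K₃ (fun _ => h₁.1) (fun _ => h₁.2) (fun _ _ _ => le_rfl) (fun _ => h₂.1) (fun _ => h₂.2) (fun _ _ _ => le_rfl)
    (fun _ => h₃.1) (fun _ => h₃.2) (fun _ _ _ => le_rfl) (fun b' => by rw [tc_const]) b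

/-- Law level: `0 ≤ E₃^{coin q}` for every triple of independent caterpillar read-once functions and every coin weight. [this work] -/
theorem sahiE_three_coin_litAdjoin_const_nonneg (m : ℕ) (K₁ K₂ K₃ : Fin m → Kind) {c₁ c₂ c₃ : ℝ} (h₁ : 0 ≤ c₁ ∧ c₁ ≤ 1) (h₂ : 0 ≤ c₂ ∧ c₂ ≤ 1)
    (h₃ : 0 ≤ c₃ ∧ c₃ ≤ 1) {q : Fin (d + m) → ℝ} (hq : ∀ i, 0 ≤ q i ∧ q i ≤ 1) :
    0 ≤ sahiE (coinWeight q) 3 ![litAdjoin m K₁ (fun _ : Pt d => c₁), litAdjoin m K₂ (fun _ : Pt d => c₂), litAdjoin m K₃ (fun _ : Pt d => c₃)] :=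
  sahiE_three_coin_nonneg_of_tc hq fun b => tc_litAdjoin_const_nonneg m K₁ K₂ K₃ h₁ h₂ h₃ b

end

end Summit.CriticalPhenomena.PercolationContinuityZ3.Theorems.SahiThreeCopy
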